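import Summits.BirchSwinnertonDyer.Rank1Residual.P2.CongruentNumberThetaCriterion
import Summits.BirchSwinnertonDyer.Rank1Residual.P2.CongruentNumberThetaThreePrimesBFamily
import HarnessLib
import HarnessLib.Audit.Tags

/-!
# Cell «bsd-monsky» (prover-B): the `k = 3` type `(3, 5, 5)` THROUGH THE UNIFORM Θ-CRITERION —
# `n = 2p₁p₂p₃`, `p₁ ≡ 3`, `p₂ ≡ p₃ ≡ 5 (mod 8)`: `θ`-controlled, Θ-certificate `Θ(n) = g(n) + 𝓛(p₂p₃)·g(2p₁)`, and the
# configuration facts `g(n) ≡ 1 + s₀s₁ + s₀s₂ + s₁s₂`, `g(2p₁)` odd, `g(p₂p₃)` even, `s(n) = 1` (kernel theorem; nothing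
# asserted, nothing booked)

HONEST FRAMING (cell `bsd-monsky`, run/shared/lean/pub/bsd-monsky/; README §1/§3): the cell's CLAIMED theorem is Monsky's
1990 conjecture on the `k = 2` family `𝒮⁻`; «ℓ ≥ 3 rungs (C-P2-2 for k ≥ 3) are NOT claimed — record what the same argument
gives there, no more». THIS FILE IS THAT RECORD for a THIRD `θ`-controlled `k = 3` type of the scope note HOME/proof/PROOF-B-K3-SCOPE.md
(census kit j246343: type `[3,5,5]`), and the FIRST one done through the UNIFORM Θ-criterion `ThetaDescent.odd_scriptL_of_thetaCert`
(`P2/CongruentNumberThetaCriterion.lean`, this generation) instead of a hand-made point-level descent: the per-type work is now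
residue arithmetic (control + certificate) and the configuration calculus (`decide`). Nothing is asserted: every statement is
CONDITIONAL on TYZ data `D` with the displayed printed sentences (`D.Printed`, `D.CMPointGaloisPrinted` — what the Literature
named fact `tyz_cmPointGaloisData` provides), on TYZ Thm. 1.1 as the named fact `thm11_parity_of_scriptL` (for `𝓛(p₂p₃) mod 2`),
and on a rank input (GZK by name) where said; Rédei–Reichardt is the tree's THEOREM `redeiReichardt_fourTwoCard_classGroup_holds`.
No conjecture is discharged, no count moves, no class is booked. NOT refereed; not part of PROOF-B v1.3 or of the paper.

THE TYPE. Primes `p₁ ≡ 3`, `p₂ ≡ p₃ ≡ 5 (mod 8)` (`p₂ ≠ p₃`), `m = p₁p₂p₃ ≡ 3`, `n = 2m ≡ 6 (mod 8)`. Blocks of TYZ's recursion: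
`6`-blocks `n, 2p₁, 2p₁p₂, 2p₁p₃`; `7`-blocks `p₁p₂, p₁p₃`; `5`-blocks `p₂, p₃` (`p₂p₃ ≡ 1`, `m ≡ 3`, `2p₂, 2p₃, 2p₂p₃ ≡ 2`).
CONTROL: every `5`-divisor of `n` is a prime `≡ 1 (mod 4)` — `n` is `θ`-controlled. CERTIFICATE: the `6`-blocks with cofactor
`≡ 1 (mod 8)` are `n` (cofactor `1`) and `2p₁` (cofactor `p₂p₃ ≡ 1`); `R(n) ∩ {≡ 6} = {2p₁}`, `R(2p₁) ∩ {≡ 6} = ∅`; so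
`Θ(2p₁) = g(2p₁)`, **`Θ(n) = g(n) + 𝓛(p₂p₃)·g(2p₁)`**. CONFIGURATION (bits `s₀ = [(p₂/p₁) = −1]`, `s₁ = [(p₃/p₁) = −1]`,
`s₂ = [(p₃/p₂) = −1]`; `decide`): `g(n) ≡ 1 + s₀s₁ + s₀s₂ + s₁s₂`, `g(2p₁)` odd, `g(p₂p₃)` even (hence `𝓛(p₂p₃)` even by
Thm. 1.1), Monsky's `s(n) = 1` for ALL bit patterns, TYZ's `Σ₂′(n) ≡ 1 + s₀ + s₁ + s₀s₁ + s₀s₂ + s₁s₂`. Hence `Θ(n) ≡ g(n)`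
is ODD iff AT MOST ONE of `(p₂/p₁), (p₃/p₁), (p₃/p₂)` is `−1`; among these four patterns `Σ₂′` is EVEN (TYZ Thm. 1.2 silent)
exactly for `(s₀, s₁, s₂) = (0,1,0), (1,0,0)` — the census types `[3,5,5]/[0,1,0]` (`2262`) and `[1,0,0]` (`1830`). The family
theorems are in the companion file `P2/CongruentNumberThetaThreePrimesCFamily.lean`.

References: [TianYuanZhang2017] Thm. 1.1, §3.1 (J738–J739, p0011 L67–L73), Prop. 3.2, Thm. 3.5, Thm. 3.6 (J741), proof of
Lemma 3.21 (J759); [HeathBrown1994SelmerCongruentII] Appendix (Monsky) p. 41 L20–L36; [LiMa2008] Thm. 0.4, Lemma 0.1;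
[IrelandRosen1990] Ch. 5 §2 Thm. 1; HOME/proof/PROOF-B-K3-SCOPE.md §2–§4; HOME/proof/PROOF-B-THETA-CRITERION.md §4.
-/

noncomputable section

open scoped Classical

open Matrix Finset WeierstrassCurve Literature.NumberTheory.EllipticCurves
  Literature.NumberTheory.EllipticCurves.Rank1Residual
  Literature.NumberTheory.EllipticCurves.Rank1Residual.Typed
  Literature.NumberTheory.EllipticCurves.HeathBrown1994
  Literature.NumberTheory.EllipticCurves.Tian2014
  Literature.NumberTheory.EllipticCurves.TianYuanZhang2017
  Literature.NumberTheory.EllipticCurves.TianYuanZhang2017.W2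
  Literature.NumberTheory.QuadraticFields.RedeiReichardt

set_option autoImplicit false

namespace Summit.BirchSwinnertonDyer.Rank1Residual.P2

namespace ThetaDescent

/-! ## §1 The configuration of the type `(3, 5, 5)` and its finite checks -/

section Cfg

variable {p₁ p₂ p₃ : ℕ}

/-- The prime triple of the type `(3, 5, 5)`: primes, none `2`, injective. [cite: HardyWright2008, §1.3 Thm. 2] -/
theorem triple_355 (hp₁ : p₁.Prime) (hp₂ : p₂.Prime) (hp₃ : p₃.Prime) (h₁ : p₁ % 8 = 3) (h₂ : p₂ % 8 = 5)
    (h₃ : p₃ % 8 = 5) (h23 : p₂ ≠ p₃) :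
    (∀ i, ((![p₁, p₂, p₃] : Fin 3 → ℕ) i).Prime) ∧ (∀ i, (![p₁, p₂, p₃] : Fin 3 → ℕ) i ≠ 2) ∧
      Function.Injective (![p₁, p₂, p₃] : Fin 3 → ℕ) := by
  have h12 : p₁ ≠ p₂ := fun h => by omega
  have h13 : p₁ ≠ p₃ := fun h => by omega
  refine ⟨fun i => by fin_cases i <;> assumption, fun i => by fin_cases i <;> simp <;> omega, ?_⟩
  intro i j h
  fin_cases i <;> fin_cases j <;> simp_all

/-- **The Legendre configuration of the type `(3, 5, 5)`**: residues `(3, 5, 5)`, bits `betaOf (3,5,5) (s₀, s₁, s₂)` with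
`s₀ = [(p₂/p₁) = −1]`, `s₁ = [(p₃/p₁) = −1]`, `s₂ = [(p₃/p₂) = −1]` (all transposed bits equal: `p₂, p₃ ≡ 1 (mod 4)`).
[cite: IrelandRosen1990, Ch. 5 §2 Thm. 1 (quadratic reciprocity)] -/
theorem cfg_355 (hp₁ : p₁.Prime) (hp₂ : p₂.Prime) (hp₃ : p₃.Prime) (h₁ : p₁ % 8 = 3) (h₂ : p₂ % 8 = 5)
    (h₃ : p₃ % 8 = 5) (h23 : p₂ ≠ p₃) :
    (fun i => (![p₁, p₂, p₃] : Fin 3 → ℕ) i % 8) = ![3, 5, 5] ∧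
    (fun a b => kroneckerBit ((![p₁, p₂, p₃] : Fin 3 → ℕ) b) ((![p₁, p₂, p₃] : Fin 3 → ℕ) a)) =
      betaOf ![3, 5, 5] ![kroneckerBit p₂ p₁, kroneckerBit p₃ p₁, kroneckerBit p₃ p₂] := by
  have hp₁2 : p₁ ≠ 2 := by omega
  have hp₂2 : p₂ ≠ 2 := by omega
  have hp₃2 : p₃ ≠ 2 := by omega
  have h12 : p₁ ≠ p₂ := fun h => by omega
  have h13 : p₁ ≠ p₃ := fun h => by omega
  have h14 : p₁ % 4 = 3 := by omega
  have h24 : p₂ % 4 = 1 := by omega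
  have h34 : p₃ % 4 = 1 := by omega
  refine ⟨?_, ?_⟩
  · funext i; fin_cases i <;> simp [h₁, h₂, h₃]
  · funext a b
    fin_cases a <;> fin_cases b
    · simpa [betaOf] using kroneckerBit_self hp₁
    · simp [betaOf]
    · simp [betaOf]
    · simp [betaOf, kroneckerBit_swap hp₁ hp₂ hp₁2 hp₂2 h12, chi4Bit, h14, h24]
    · simpa [betaOf] using kroneckerBit_self hp₂
    · simp [betaOf]
    · simp [betaOf, kroneckerBit_swap hp₁ hp₃ hp₁2 hp₃2 h13, chi4Bit, h14, h34]
    · simp [betaOf, kroneckerBit_swap hp₂ hp₃ hp₂2 hp₃2 h23, chi4Bit, h24, h34]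
    · simpa [betaOf] using kroneckerBit_self hp₃

end Cfg

/-- **Monsky's even matrix on the type `(3, 5, 5)` has a `2`-element kernel for EVERY bit pattern** (`s(n) = 1` on the whole
type). [cite: HeathBrown1994SelmerCongruentII, Appendix (Monsky), typescript p. 41 L20–L36] -/
theorem card_ker_monskyCfgEven_355 : ∀ s₀ s₁ s₂ : ZMod 2,
    Fintype.card {v : Fin 3 ⊕ Fin 3 → ZMod 2 //
      monskyCfgEven ![3, 5, 5] (betaOf ![3, 5, 5] ![s₀, s₁, s₂]) *ᵥ v = 0} = 2 := by
  decide

/-- **The Rédei bit of `ℚ(√−2p₁p₂p₃)` on the type `(3, 5, 5)` is `1 + s₀s₁ + s₀s₂ + s₁s₂`** (`g(n)` odd iff at most one of the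
three bits is set). [cite: LiMa2008, Thm. 0.4 with Lemma 0.1, Def. 0.2 (p. 279)] -/
theorem gBitCfgTwo_355 : ∀ s₀ s₁ s₂ : ZMod 2,
    gBitCfgTwo ![3, 5, 5] (betaOf ![3, 5, 5] ![s₀, s₁, s₂]) = 1 + s₀ * s₁ + s₀ * s₂ + s₁ * s₂ := by
  decide

/-- The Rédei bit of the even sub-block `ℚ(√−2p₁)`, `p₁ ≡ 3 (mod 8)`: `g(2p₁)` is ODD. [cite: LiMa2008, Thm. 0.4] -/
theorem gBitTwoSub_355_zero : ∀ s₀ s₁ s₂ : ZMod 2,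
    gBitTwoSub ![0] ![3, 5, 5] (betaOf ![3, 5, 5] ![s₀, s₁, s₂]) = 1 := by
  decide

/-- The Rédei bit of the odd sub-block `ℚ(√−p₂p₃)`, `p₂ ≡ p₃ ≡ 5 (mod 8)` (discriminant `−4p₂p₃`, `t = 3`): `g(p₂p₃)` is EVEN for
every bit pattern. [cite: LiMa2008, Thm. 0.4] -/
theorem gBitSub_355_oneTwo : ∀ s₀ s₁ s₂ : ZMod 2,
    gBitSub ![1, 2] ![3, 5, 5] (betaOf ![3, 5, 5] ![s₀, s₁, s₂]) = 0 := by
  decide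

/-- **TYZ's `Σ₂′` on the type `(3, 5, 5)` is `1 + s₀ + s₁ + s₀s₁ + s₀s₂ + s₁s₂` mod `2`**; in particular it VANISHES for
`(s₀, s₁, s₂) = (0,1,0), (1,0,0)` (the genus criterion is silent there). [cite: TianYuanZhang2017, Thm. 1.2 (the second sum for n ≡ 6 (mod 8))] -/
theorem sigma2'CfgEven_355 : ∀ s₀ s₁ s₂ : ZMod 2,
    sigma2'CfgEven ![3, 5, 5] (betaOf ![3, 5, 5] ![s₀, s₁, s₂]) = 1 + s₀ + s₁ + s₀ * s₁ + s₀ * s₂ + s₁ * s₂ := by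
  decide

/-! ## §2 Transfers to the primes -/

section Transfer

variable {p₁ p₂ p₃ : ℕ}

/-- **Monsky's `s(2p₁p₂p₃) = 1` on the whole type `(3, 5, 5)`** (kernel-decided). [cite: HeathBrown1994SelmerCongruentII, Appendix (Monsky), typescript p. 41 L36] -/
theorem monskySelmerRankEven_355 (hp₁ : p₁.Prime) (hp₂ : p₂.Prime) (hp₃ : p₃.Prime) (h₁ : p₁ % 8 = 3)
    (h₂ : p₂ % 8 = 5) (h₃ : p₃ % 8 = 5) (h23 : p₂ ≠ p₃) : monskySelmerRankEven ![p₁, p₂, p₃] = 1 := by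
  obtain ⟨ht, ht2, hinj⟩ := triple_355 hp₁ hp₂ hp₃ h₁ h₂ h₃ h23
  obtain ⟨hR, hB⟩ := cfg_355 hp₁ hp₂ hp₃ h₁ h₂ h₃ h23
  rw [monskySelmerRankEven_eq_one_iff_card_ker, card_ker_monskyMatrixEven_eq_cfg _ ht ht2 hinj]
  have hmat : monskyCfgEven (fun i => (![p₁, p₂, p₃] : Fin 3 → ℕ) i % 8)
      (fun a b => kroneckerBit ((![p₁, p₂, p₃] : Fin 3 → ℕ) b) ((![p₁, p₂, p₃] : Fin 3 → ℕ) a)) =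
      monskyCfgEven ![3, 5, 5] (betaOf ![3, 5, 5] ![kroneckerBit p₂ p₁, kroneckerBit p₃ p₁, kroneckerBit p₃ p₂]) := by
    rw [hR, hB]
  rw [Fintype.card_congr (Equiv.subtypeEquivRight fun v => by rw [hmat])]
  exact card_ker_monskyCfgEven_355 _ _ _

/-- **`g(2p₁p₂p₃)` odd ⟺ `s₀s₁ + s₀s₂ + s₁s₂ = 0`** (at most one of `(p₂/p₁), (p₃/p₁), (p₃/p₂)` is `−1`) on the type `(3, 5, 5)`
(RR instantiated). [cite: LiMa2008, Thm. 0.4] [cite: TianYuanZhang2017, §1 (p0002 L78–L82: g(d))] -/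
theorem odd_gK_two_mul_355_iff_bits (hp₁ : p₁.Prime) (hp₂ : p₂.Prime) (hp₃ : p₃.Prime) (h₁ : p₁ % 8 = 3)
    (h₂ : p₂ % 8 = 5) (h₃ : p₃ % 8 = 5) (h23 : p₂ ≠ p₃) :
    Odd (gK (2 * (p₁ * p₂ * p₃))) ↔
      kroneckerBit p₂ p₁ * kroneckerBit p₃ p₁ + kroneckerBit p₂ p₁ * kroneckerBit p₃ p₂ +
        kroneckerBit p₃ p₁ * kroneckerBit p₃ p₂ = 0 := by
  obtain ⟨ht, ht2, hinj⟩ := triple_355 hp₁ hp₂ hp₃ h₁ h₂ h₃ h23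
  obtain ⟨hR, hB⟩ := cfg_355 hp₁ hp₂ hp₃ h₁ h₂ h₃ h23
  have hprod : 2 * ∏ i, (![p₁, p₂, p₃] : Fin 3 → ℕ) i = 2 * (p₁ * p₂ * p₃) := by rw [Fin.prod_univ_three]; rfl
  have h := natCast_genusClassNumber_two_mul_eq_gBitCfgTwo redeiReichardt_fourTwoCard_classGroup_holds _ ht ht2 hinj
  rw [hprod, hR, hB, gBitCfgTwo_355] at h
  unfold gK
  rw [← ZMod.natCast_eq_one_iff_odd, h]
  have key : ∀ a b c : ZMod 2, 1 + a * b + a * c + b * c = 1 ↔ a * b + a * c + b * c = 0 := by decide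
  exact key _ _ _

/-- **`g(2p₁)` is ODD** (`p₁ ≡ 3 (mod 8)`; read through the type's configuration, RR instantiated). [cite: LiMa2008, Thm. 0.4] -/
theorem odd_gK_two_mul_of_355 (hp₁ : p₁.Prime) (hp₂ : p₂.Prime) (hp₃ : p₃.Prime) (h₁ : p₁ % 8 = 3) (h₂ : p₂ % 8 = 5)
    (h₃ : p₃ % 8 = 5) (h23 : p₂ ≠ p₃) : Odd (gK (2 * p₁)) := by
  obtain ⟨ht, ht2, hinj⟩ := triple_355 hp₁ hp₂ hp₃ h₁ h₂ h₃ h23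
  obtain ⟨hR, hB⟩ := cfg_355 hp₁ hp₂ hp₃ h₁ h₂ h₃ h23
  have h := natCast_genusClassNumber_two_mul_eq_gBitTwoSub redeiReichardt_fourTwoCard_classGroup_holds _ ht ht2 hinj
    (![0] : Fin 1 → Fin 3) (fun i j h => by fin_cases i; fin_cases j; rfl)
  have hprod : 2 * ∏ i : Fin 1, (![p₁, p₂, p₃] : Fin 3 → ℕ) ((![0] : Fin 1 → Fin 3) i) = 2 * p₁ := by
    rw [Fin.prod_univ_one]; rfl
  rw [hprod, hR, hB, gBitTwoSub_355_zero] at h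
  unfold gK
  rw [← ZMod.natCast_eq_one_iff_odd, h]

/-- **`g(p₂p₃)` is EVEN** (`p₂ ≡ p₃ ≡ 5 (mod 8)`; read through the type's configuration, RR instantiated). [cite: LiMa2008, Thm. 0.4] -/
theorem not_odd_gK_mul_of_355 (hp₁ : p₁.Prime) (hp₂ : p₂.Prime) (hp₃ : p₃.Prime) (h₁ : p₁ % 8 = 3) (h₂ : p₂ % 8 = 5)
    (h₃ : p₃ % 8 = 5) (h23 : p₂ ≠ p₃) : ¬ Odd (gK (p₂ * p₃)) := by
  obtain ⟨ht, ht2, hinj⟩ := triple_355 hp₁ hp₂ hp₃ h₁ h₂ h₃ h23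
  obtain ⟨hR, hB⟩ := cfg_355 hp₁ hp₂ hp₃ h₁ h₂ h₃ h23
  have h := natCast_genusClassNumber_eq_gBitSub redeiReichardt_fourTwoCard_classGroup_holds _ ht ht2 hinj
    (![1, 2] : Fin 2 → Fin 3) (fun i j h => by fin_cases i <;> fin_cases j <;> simp_all)
  have hprod : ∏ i : Fin 2, (![p₁, p₂, p₃] : Fin 3 → ℕ) ((![1, 2] : Fin 2 → Fin 3) i) = p₂ * p₃ := by
    rw [Fin.prod_univ_two]; rfl
  rw [hprod, hR, hB, gBitSub_355_oneTwo] at h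
  unfold gK
  rw [← ZMod.natCast_eq_one_iff_odd, h]
  exact zero_ne_one

/-- **`𝓛(p₂p₃)` is EVEN, for ANY sign choice**, from TYZ Thm. 1.1 (`h11` = `thm11_parity_of_scriptL`: `p₂p₃ ≡ 1 (mod 8)`,
`𝓛(p₂p₃) ≡ Σ₁(p₂p₃) = g(p₂p₃) (mod 2)`) and `g(p₂p₃)` even. CONDITIONAL on `h11`. [cite: TianYuanZhang2017, Thm. 1.1 (p0002 L90–L99)] -/
theorem even_of_isScriptL_mul_355 (h11 : thm11_parity_of_scriptL) (hp₁ : p₁.Prime) (hp₂ : p₂.Prime) (hp₃ : p₃.Prime)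
    (h₁ : p₁ % 8 = 3) (h₂ : p₂ % 8 = 5) (h₃ : p₃ % 8 = 5) (h23 : p₂ ≠ p₃) {L : ℤ} (hL : IsScriptL (p₂ * p₃) L) :
    Even L := by
  have h23m : (p₂ * p₃) % 8 = 1 := by rw [Nat.mul_mod, h₂, h₃]
  have hsq : Squarefree (p₂ * p₃) := by
    rw [Nat.squarefree_mul ((Nat.coprime_primes hp₂ hp₃).mpr h23)]
    exact ⟨hp₂.squarefree, hp₃.squarefree⟩
  obtain ⟨L', hL', hpar⟩ := h11 (p₂ * p₃) hsq (Or.inl h23m) GenusField (isGenusFieldFamily_genusField _)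
  rw [genusSum₁_prime_mul hp₂ hp₃ h23 (by omega) (by omega)] at hpar
  have hg0 : ((genusClassNumber (GenusField (p₂ * p₃)) : ℕ) : ZMod 2) = 0 := by
    rcases Nat.even_or_odd (genusClassNumber (GenusField (p₂ * p₃))) with he | ho
    · exact (ZMod.natCast_eq_zero_iff_even.mpr he)
    · exact absurd ho (not_odd_gK_mul_of_355 hp₁ hp₂ hp₃ h₁ h₂ h₃ h23)
  rw [hg0] at hpar
  have hL'even : Even L' := (ZMod.intCast_eq_zero_iff_even.mp hpar)
  have hsq' : L ^ 2 = L' ^ 2 := by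
    have h : ((L : ℂ)) ^ 2 = ((L' : ℂ)) ^ 2 := by rw [hL, hL']
    exact_mod_cast h
  rcases sq_eq_sq_iff_eq_or_eq_neg.mp hsq' with h | h
  · rw [h]; exact hL'even
  · rw [h]; exact hL'even.neg

end Transfer

/-! ## §3 The type is `θ`-controlled and its Θ-certificate is `Θ(n) = g(n) + 𝓛(p₂p₃)·g(2p₁)` -/

section Cert

variable {p₁ p₂ p₃ : ℕ}

/-- `recursionIndex (2p)` contains no `6`-block, for any prime `p` (the only even divisor `≡ 6` could be `2p` itself, whose
cofactor is `1`). [cite: TianYuanZhang2017, §3.1 (p0011 L67–L70)] -/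
theorem filter_six_recursionIndex_two_mul_prime {p : ℕ} (hp : p.Prime) :
    (recursionIndex (2 * p)).filter (fun d₀ => d₀ % 8 = 6) = ∅ := by
  apply Finset.filter_eq_empty_iff.mpr
  intro d₀ hd₀ h6
  obtain ⟨hd, -, -, hgt⟩ := mem_recursionIndex_iff.mp hd₀
  obtain ⟨hdvd, h0⟩ := Nat.mem_divisors.mp hd
  have hpodd := hp.eq_two_or_odd
  have hself : 2 * p / (2 * p) = 1 := Nat.div_self (by omega)
  rcases (dvd_prime_mul_prime_iff Nat.prime_two hp).mp hdvd with rfl | rfl | rfl | rfl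
  · omega
  · omega
  · omega
  · rw [hself] at hgt; omega

/-- **Every `5`-divisor of `n = 2p₁p₂p₃` (type `(3, 5, 5)`) is a prime `≡ 1 (mod 4)`** (`p₂` or `p₃`): all `5`-divisors are
GOOD, so `n` is `θ`-controlled. [cite: TianYuanZhang2017, §3.1 (p0011 L67–L70)] -/
theorem fiveGood_of_dvd_two_mul_355 (hp₁ : p₁.Prime) (hp₂ : p₂.Prime) (hp₃ : p₃.Prime) (h₁ : p₁ % 8 = 3)
    (h₂ : p₂ % 8 = 5) (h₃ : p₃ % 8 = 5) {d' : ℕ} (hd' : d' ∣ 2 * (p₁ * p₂ * p₃)) (h5 : d' % 8 = 5) :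
    ∀ r ∈ d'.primeFactors, r % 4 = 1 := by
  have h12m : (p₁ * p₂) % 8 = 7 := by rw [Nat.mul_mod, h₁, h₂]
  have h13m : (p₁ * p₃) % 8 = 7 := by rw [Nat.mul_mod, h₁, h₃]
  have h23m : (p₂ * p₃) % 8 = 1 := by rw [Nat.mul_mod, h₂, h₃]
  have hm3 : (p₁ * p₂ * p₃) % 8 = 3 := by rw [Nat.mul_mod, h12m, h₃]
  rcases (dvd_two_mul_three_iff hp₁ hp₂ hp₃).mp hd' with
    (rfl | rfl | rfl | rfl | rfl | rfl | rfl | rfl) | (rfl | rfl | rfl | rfl | rfl | rfl | rfl | rfl)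
  · omega
  · omega
  · intro r hr; rw [hp₂.primeFactors, Finset.mem_singleton] at hr; omega
  · intro r hr; rw [hp₃.primeFactors, Finset.mem_singleton] at hr; omega
  · omega
  · omega
  · omega
  · omega
  all_goals omega

/-- **`2p₁p₂p₃` (type `(3, 5, 5)`) is `θ`-controlled.** [cite: TianYuanZhang2017, §3.1 (p0011 L67–L70)] -/
theorem thetaControlled_two_mul_355 (hp₁ : p₁.Prime) (hp₂ : p₂.Prime) (hp₃ : p₃.Prime) (h₁ : p₁ % 8 = 3)
    (h₂ : p₂ % 8 = 5) (h₃ : p₃ % 8 = 5) :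
    ∀ d₀ ∈ (2 * (p₁ * p₂ * p₃)).divisors, d₀ % 8 = 7 → (2 * (p₁ * p₂ * p₃) / d₀) % 8 = 2 →
      ∀ d' ∈ d₀.divisors, d' % 8 = 5 → ∀ r ∈ d'.primeFactors, r % 4 = 1 := fun _ hd₀ _ _ _ hd' h5 =>
  fiveGood_of_dvd_two_mul_355 hp₁ hp₂ hp₃ h₁ h₂ h₃ ((Nat.mem_divisors.mp hd').1.trans (Nat.mem_divisors.mp hd₀).1) h5

/-- **The `6`-blocks of `R(2p₁p₂p₃)` (type `(3, 5, 5)`): exactly `{2p₁}`** (cofactor `p₂p₃ ≡ 1`; `2p₁p₂`, `2p₁p₃` have cofactors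
`≡ 5`). [cite: TianYuanZhang2017, §3.1 (p0011 L67–L70)] -/
theorem filter_six_recursionIndex_355 (hp₁ : p₁.Prime) (hp₂ : p₂.Prime) (hp₃ : p₃.Prime) (h₁ : p₁ % 8 = 3)
    (h₂ : p₂ % 8 = 5) (h₃ : p₃ % 8 = 5) :
    (recursionIndex (2 * (p₁ * p₂ * p₃))).filter (fun d₀ => d₀ % 8 = 6) = {2 * p₁} := by
  have h12m : (p₁ * p₂) % 8 = 7 := by rw [Nat.mul_mod, h₁, h₂]
  have h13m : (p₁ * p₃) % 8 = 7 := by rw [Nat.mul_mod, h₁, h₃]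
  have h23m : (p₂ * p₃) % 8 = 1 := by rw [Nat.mul_mod, h₂, h₃]
  have hm3 : (p₁ * p₂ * p₃) % 8 = 3 := by rw [Nat.mul_mod, h12m, h₃]
  have hn0 : 2 * (p₁ * p₂ * p₃) ≠ 0 :=
    Nat.mul_ne_zero two_ne_zero (Nat.mul_ne_zero (Nat.mul_ne_zero hp₁.ne_zero hp₂.ne_zero) hp₃.ne_zero)
  have e2p₁ : 2 * (p₁ * p₂ * p₃) / (2 * p₁) = p₂ * p₃ := by
    rw [show 2 * (p₁ * p₂ * p₃) = (2 * p₁) * (p₂ * p₃) by ring]; exact Nat.mul_div_cancel_left _ (by omega)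
  have e2p₁p₂ : 2 * (p₁ * p₂ * p₃) / (2 * (p₁ * p₂)) = p₃ := by
    rw [show 2 * (p₁ * p₂ * p₃) = (2 * (p₁ * p₂)) * p₃ by ring]
    exact Nat.mul_div_cancel_left _ (Nat.mul_pos two_pos (Nat.mul_pos hp₁.pos hp₂.pos))
  have e2p₁p₃ : 2 * (p₁ * p₂ * p₃) / (2 * (p₁ * p₃)) = p₂ := by
    rw [show 2 * (p₁ * p₂ * p₃) = (2 * (p₁ * p₃)) * p₂ by ring]
    exact Nat.mul_div_cancel_left _ (Nat.mul_pos two_pos (Nat.mul_pos hp₁.pos hp₃.pos))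
  ext d₀
  simp only [Finset.mem_filter, mem_recursionIndex_iff, Nat.mem_divisors, Finset.mem_singleton]
  constructor
  · rintro ⟨⟨⟨hd, -⟩, h567, h123, hgt⟩, h6⟩
    rcases (dvd_two_mul_three_iff hp₁ hp₂ hp₃).mp hd with
      (rfl | rfl | rfl | rfl | rfl | rfl | rfl | rfl) | (rfl | rfl | rfl | rfl | rfl | rfl | rfl | rfl)
    · omega
    · omega
    · omega
    · omega
    · omega
    · omega
    · omega
    · omega
    · omega
    · rfl
    · omega
    · omega
    · rw [e2p₁p₂] at h123; omega
    · rw [e2p₁p₃] at h123; omega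
    · omega
    · rw [Nat.div_self (Nat.pos_of_ne_zero hn0)] at hgt; omega
  · rintro rfl
    refine ⟨⟨⟨Dvd.intro (p₂ * p₃) (by ring), hn0⟩, Or.inr (Or.inl (by omega)), ?_, ?_⟩, by omega⟩
    · rw [e2p₁]; omega
    · rw [e2p₁]; have := Nat.mul_le_mul hp₂.two_le hp₃.two_le; omega

/-- **The Θ-certificate of the type `(3, 5, 5)`**: `s(2p₁) = g(2p₁)`, `s(e) = g(n) + 𝓛(p₂p₃)·g(2p₁)` otherwise, satisfies the
certificate equations on the `6`-blocks `e ∣ n` with `n/e ≡ 1 (mod 8)` (these are `n` and `2p₁`).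
[cite: TianYuanZhang2017, §3.1 (p0011 L67–L73)] -/
theorem thetaCert_two_mul_355 (hp₁ : p₁.Prime) (hp₂ : p₂.Prime) (hp₃ : p₃.Prime) (h₁ : p₁ % 8 = 3) (h₂ : p₂ % 8 = 5)
    (h₃ : p₃ % 8 = 5) (D : GenusPointData (2 * (p₁ * p₂ * p₃))) :
    ∀ e ∈ (2 * (p₁ * p₂ * p₃)).divisors, e % 8 = 6 → (2 * (p₁ * p₂ * p₃) / e) % 8 = 1 →
      (fun e : ℕ => if e = 2 * p₁ then (gK (2 * p₁) : ZMod 2) else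
          (gK (2 * (p₁ * p₂ * p₃)) : ZMod 2) + (D.scriptL (p₂ * p₃) : ZMod 2) * (gK (2 * p₁) : ZMod 2)) e =
        (gK e : ZMod 2) +
          ∑ d₀ ∈ (recursionIndex e).filter (fun d₀ => d₀ % 8 = 6), (D.scriptL (e / d₀) : ZMod 2) *
            (fun e : ℕ => if e = 2 * p₁ then (gK (2 * p₁) : ZMod 2) else
              (gK (2 * (p₁ * p₂ * p₃)) : ZMod 2) + (D.scriptL (p₂ * p₃) : ZMod 2) * (gK (2 * p₁) : ZMod 2)) d₀ := by
  intro e he he6 hq1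
  have h12m : (p₁ * p₂) % 8 = 7 := by rw [Nat.mul_mod, h₁, h₂]
  have h13m : (p₁ * p₃) % 8 = 7 := by rw [Nat.mul_mod, h₁, h₃]
  have h23m : (p₂ * p₃) % 8 = 1 := by rw [Nat.mul_mod, h₂, h₃]
  have hm3 : (p₁ * p₂ * p₃) % 8 = 3 := by rw [Nat.mul_mod, h12m, h₃]
  have hn0 : 2 * (p₁ * p₂ * p₃) ≠ 0 :=
    Nat.mul_ne_zero two_ne_zero (Nat.mul_ne_zero (Nat.mul_ne_zero hp₁.ne_zero hp₂.ne_zero) hp₃.ne_zero)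
  have e2p₁ : 2 * (p₁ * p₂ * p₃) / (2 * p₁) = p₂ * p₃ := by
    rw [show 2 * (p₁ * p₂ * p₃) = (2 * p₁) * (p₂ * p₃) by ring]; exact Nat.mul_div_cancel_left _ (by omega)
  have e2p₁p₂ : 2 * (p₁ * p₂ * p₃) / (2 * (p₁ * p₂)) = p₃ := by
    rw [show 2 * (p₁ * p₂ * p₃) = (2 * (p₁ * p₂)) * p₃ by ring]
    exact Nat.mul_div_cancel_left _ (Nat.mul_pos two_pos (Nat.mul_pos hp₁.pos hp₂.pos))
  have e2p₁p₃ : 2 * (p₁ * p₂ * p₃) / (2 * (p₁ * p₃)) = p₂ := by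
    rw [show 2 * (p₁ * p₂ * p₃) = (2 * (p₁ * p₃)) * p₂ by ring]
    exact Nat.mul_div_cancel_left _ (Nat.mul_pos two_pos (Nat.mul_pos hp₁.pos hp₃.pos))
  have hne : 2 * (p₁ * p₂ * p₃) ≠ 2 * p₁ := by
    intro h
    have h' : p₁ * (p₂ * p₃) = p₁ * 1 := by rw [← mul_assoc, mul_one]; omega
    have h'' := Nat.eq_of_mul_eq_mul_left hp₁.pos h'
    have := Nat.mul_le_mul hp₂.two_le hp₃.two_le
    omega
  -- `e = n` or `e = 2p₁`
  have hen : e = 2 * (p₁ * p₂ * p₃) ∨ e = 2 * p₁ := by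
    rcases (dvd_two_mul_three_iff hp₁ hp₂ hp₃).mp (Nat.mem_divisors.mp he).1 with
      (rfl | rfl | rfl | rfl | rfl | rfl | rfl | rfl) | (rfl | rfl | rfl | rfl | rfl | rfl | rfl | rfl)
    · omega
    · omega
    · omega
    · omega
    · omega
    · omega
    · omega
    · omega
    · omega
    · exact Or.inr rfl
    · omega
    · omega
    · rw [e2p₁p₂] at hq1; omega
    · rw [e2p₁p₃] at hq1; omega
    · omega
    · exact Or.inl rfl
  rcases hen with rfl | rfl
  · -- `e = n`: `R(n) ∩ {≡ 6} = {2p₁}`, cofactor `p₂p₃`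
    simp only [if_neg hne, filter_six_recursionIndex_355 hp₁ hp₂ hp₃ h₁ h₂ h₃, Finset.sum_singleton, if_true, e2p₁]
  · -- `e = 2p₁`: `R(2p₁) ∩ {≡ 6} = ∅`
    simp only [if_true, filter_six_recursionIndex_two_mul_prime hp₁, Finset.sum_empty, add_zero]

end Cert


/-! ## §4 (appendix) Where `θ` decides and TYZ is silent on the type `(3, 5, 5)`, as one bit identity -/

/-- **The silent half of the `θ`-family, as a bit identity**: on the patterns with `g(n)` odd (`s₀s₁ + s₀s₂ + s₁s₂ = 0`, i.e. at most one
bit set) TYZ's `Σ₂′ ≡ 1 + s₀ + s₁ + s₀s₁ + s₀s₂ + s₁s₂` vanishes exactly when `s₀ + s₁ = 1` — the census types `[3,5,5]/[0,1,0]`, `[1,0,0]`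
(Theorem 1.2 silent), while `(0,0,0)`, `(0,0,1)` are loud. [cite: TianYuanZhang2017, Thm. 1.2 (the second sum for n ≡ 6 (mod 8))] -/
theorem sigma2'CfgEven_355_silent_iff : ∀ s₀ s₁ s₂ : ZMod 2, s₀ * s₁ + s₀ * s₂ + s₁ * s₂ = 0 →
    (sigma2'CfgEven ![3, 5, 5] (betaOf ![3, 5, 5] ![s₀, s₁, s₂]) = 0 ↔ s₀ + s₁ = 1) := by
  decide

/-- Loud half of type `(3,5,5)`: on the `g(n)`-odd patterns TYZ's `Σ₂′` is odd iff `s₀ + s₁ = 0`. [cite: TianYuanZhang2017, Thm. 1.2 (the second sum for n ≡ 6 (mod 8))] -/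
theorem sigma2'CfgEven_355_loud_iff : ∀ s₀ s₁ s₂ : ZMod 2, s₀ * s₁ + s₀ * s₂ + s₁ * s₂ = 0 → (sigma2'CfgEven ![3, 5, 5] (betaOf ![3, 5, 5] ![s₀, s₁, s₂]) = 1 ↔ s₀ + s₁ = 0) := by decide
end ThetaDescent

end Summit.BirchSwinnertonDyer.Rank1Residual.P2

end
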